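import Literature.NumberTheory.LFunctions.YoshidaWindowGramFrontDoor
import HarnessLib

/-!
# Format C: the FAST light-table checker (all modes of a slice in one kernel pass)

Topic `Literature/NumberTheory/LFunctions` (kernel certificates of the Weil form; sibling of `YoshidaWindowGramFrontDoor`, whose
`Encl.checkTableCol` it accelerates; written for the format-C rungs of the rh-explicit programme, seat rh-explicit-weil-2).
Source of the quantities: H. Yoshida, Adv. Stud. Pure Math. **21** (1992) 281–325, §5 (5.15)–(5.16) [Yoshida1992HermitianForms]
(the special values `ω_m`, `ψ(¼ + iω_m/2)`, the exponential sums and phases of the matrix coefficients).  A format-C rung stores a LIGHT column table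
`ctab` (per mode `m`: `ω_m`, `1/(1+4ω_m²)`, `Re/Im ψ(¼+iω_m/2)`, `archExpSumSin a m`, the phases `e^{iω_mℓ_q}`) and proves
`Encl.TabColValid` for it with `Encl.checkTableCol`, which RECOMPUTES every record with the full evaluator `Encl.idxRecCol`
(shifted Stirling series with `J = 120` shift terms, complex logarithm and arctangent series of `K = 150` terms, five
`K`-term Taylor exponentials per mode): ≈ 4.3 s of kernel time per mode, 866 modes = 11 gate files for the a = 1 rung.

This file proves the SAME conclusion (`Encl.ColValid … (tget ctab m)` on a range of modes, via `Encl.ColValid.of_within`)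
from a checker that is ≈ 15× cheaper in the kernel (measured: 0.29 s/mode, 100 modes in one declaration), because for the
light-table modes (`ω_m = πm/a ≥ 500`) no shift and no general complex logarithm is needed:

* `ψ(¼ + iω/2)` by the UNSHIFTED Stirling series (`Literature…norm_digamma_sub_stirlingSeries_le`, `ν = 10` proved
  Bernoulli numbers) with the sharp remainder `(π²/3)(2ν+1)!/(2π)^{2ν+1}·4/|w|^{2ν}`, `|w| ≥ ω/2` (`digammaQuarterFast`);
* `Log(¼ + iω/2) = log(ω/2) + iπ/2 + Log(1 − it)`, `t = 1/(2ω)` (`log_quarter_add_mul_I`, `norm_log_one_sub_add_sum_le`: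
  the two lemmas of weil-10's `WeilFormatCDigammaQuarterExpansion`, re-proved here verbatim under this namespace because that
  module's farm build is pending), with `log(ω_m/2) = log π − log(2a) + log m` and `log m` carried ADDITIVELY
  along the slice (`MI.logOneSub` at `1/(m+1)`, `K₂` terms of ratio `1/m`) (`logQuarter`);
* the phases `e^{iω_mℓ_q}` by ROTATION of unit-circle balls (`Ball`, midpoint–radius form — no wrapping effect):
  a point value `e^{iφ_m/S}` tracked by `p_{m+1} = p_m · e^{iD/S}` (`φ_{m+1} = φ_m + D`, both seeds evaluated once per
  declaration at scale `S·2^g` by `MC.expI`), then widened by the phase uncertainty `max(Θ.hi − φ, φ − Θ.lo)` of the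
  mode's phase box `Θ = ω_m ⊗ ℓ_q` (`|e^{ia} − e^{ib}| ≤ |a − b|`);
* `ω_m`, `1/(1+4ω_m²)` and the exponential sum exactly as `Encl.idxRecCol` (`Encl.ssum`).

Main entries: `checkTableColFast` (the checker) and **`colValid_of_checkTableColFast`** — same hypotheses and conclusion
shape as `Encl.colValid_of_checkTableCol` (`ConstsValid S a ks C`, the check, `n0 ≤ m < n0 + k` ⟹ `ColValid S a ks m
(tget ctab m)`), so a rung's `TabColValid` glue is unchanged.  Everything is proved; standard axioms; no new mathematics
(interval arithmetic [cite: Moore1966, Ch. 3–4] around the tree's Stirling/log/exp enclosures); RH-free.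
-/

set_option autoImplicit false

open Real Complex Finset
open Literature.Analysis.ValidatedNumerics.NumericsMP Literature.Analysis.ValidatedNumerics
open Literature.Analysis.SpecialFunctions

namespace Literature.NumberTheory.LFunctions.Yoshida1992.Encl

namespace FastLight

variable {S : ℕ}

/-! ## 0. Two lemmas of `WeilFormatCDigammaQuarterExpansion` (weil-10), re-proved here (that module's olean is not yet built) -/

/-- **`Log(¼ + iy) = log y + (π/2)i + Log(1 − i/(4y))`** for `y > 0` (= `WeilFormatC.log_quarter_add_mul_I`). [folklore] -/
private theorem log_quarter_add_mul_I' {y : ℝ} (hy : 0 < y) :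
    Complex.log (1 / 4 + (y : ℂ) * I)
      = (Real.log y : ℂ) + ((π / 2 : ℝ) : ℂ) * I + Complex.log (1 - I * ((1 / (4 * y) : ℝ) : ℂ)) := by
  have hy0 : (y : ℂ) ≠ 0 := by exact_mod_cast hy.ne'
  have hyt : (y : ℂ) * ((1 / (4 * y) : ℝ) : ℂ) = 1 / 4 := by
    push_cast
    field_simp
  have hprod : (1 / 4 : ℂ) + (y : ℂ) * I = ((y : ℂ) * I) * (1 - I * ((1 / (4 * y) : ℝ) : ℂ)) := by
    rw [mul_sub, mul_one, show (y : ℂ) * I * (I * ((1 / (4 * y) : ℝ) : ℂ))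
        = (I * I) * ((y : ℂ) * ((1 / (4 * y) : ℝ) : ℂ)) by ring, Complex.I_mul_I, hyt]
    ring
  have hlogiy : Complex.log ((y : ℂ) * I) = (Real.log y : ℂ) + ((π / 2 : ℝ) : ℂ) * I := by
    rw [Complex.log_ofReal_mul hy I_ne_zero, Complex.log_I]
    push_cast
    ring
  set S : ℂ := Complex.log ((y : ℂ) * I) + Complex.log (1 - I * ((1 / (4 * y) : ℝ) : ℂ)) with hS
  have hre : (0 : ℝ) < (1 - I * ((1 / (4 * y) : ℝ) : ℂ)).re := by simp
  have harg : |Complex.arg (1 - I * ((1 / (4 * y) : ℝ) : ℂ))| < π / 2 :=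
    Complex.abs_arg_lt_pi_div_two_iff.2 (Or.inl hre)
  have hSim : S.im = π / 2 + Complex.arg (1 - I * ((1 / (4 * y) : ℝ) : ℂ)) := by
    rw [hS, Complex.add_im, hlogiy, Complex.log_im]
    simp
  have h1 : -π < S.im := by
    rw [hSim]; have := (abs_lt.1 harg).1; linarith [Real.pi_pos]
  have h2 : S.im ≤ π := by
    rw [hSim]; have := (abs_lt.1 harg).2; linarith
  have hne1 : (y : ℂ) * I ≠ 0 := mul_ne_zero hy0 I_ne_zero
  have hne2 : (1 - I * ((1 / (4 * y) : ℝ) : ℂ)) ≠ 0 := by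
    intro h; rw [h] at hre; simp at hre
  have hexp : Complex.exp S = (1 / 4 : ℂ) + (y : ℂ) * I := by
    rw [hS, Complex.exp_add, Complex.exp_log hne1, Complex.exp_log hne2, hprod]
  calc Complex.log (1 / 4 + (y : ℂ) * I) = Complex.log (Complex.exp S) := by rw [hexp]
    _ = S := Complex.log_exp h1 h2
    _ = (Real.log y : ℂ) + ((π / 2 : ℝ) : ℂ) * I + Complex.log (1 - I * ((1 / (4 * y) : ℝ) : ℂ)) := by
        rw [hS, hlogiy]

/-- **The logarithmic series on the quarter line**: for `0 ≤ t < 1`,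
`‖Log(1 − it) + Σ_{n=1}^{K} (it)ⁿ/n‖ ≤ t^{K+1}/((K+1)(1−t))` (= `WeilFormatC.norm_log_one_sub_add_sum_le`). [folklore] -/
private theorem norm_log_one_sub_add_sum_le' {t : ℝ} (ht0 : 0 ≤ t) (ht1 : t < 1) (K : ℕ) :
    ‖Complex.log (1 - I * (t : ℂ)) + ∑ n ∈ Finset.Icc 1 K, (I * t) ^ n / (n : ℂ)‖
      ≤ t ^ (K + 1) / ((K + 1) * (1 - t)) := by
  have hnorm : ‖(-(I * (t : ℂ)))‖ = t := by
    rw [norm_neg, norm_mul, Complex.norm_I, one_mul, Complex.norm_real, Real.norm_of_nonneg ht0]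
  have hz : ‖(-(I * (t : ℂ)))‖ < 1 := by rw [hnorm]; exact ht1
  have h := Complex.norm_log_sub_logTaylor_le K hz
  rw [hnorm] at h
  have hT : Complex.logTaylor (K + 1) (-(I * (t : ℂ))) = -∑ n ∈ Finset.Icc 1 K, (I * t) ^ n / (n : ℂ) := by
    rw [Complex.logTaylor, Finset.range_eq_Ico, ← Finset.sum_neg_distrib]
    have hsplit : Finset.Ico 0 (K + 1) = insert 0 (Finset.Icc 1 K) := by
      ext n; simp only [Finset.mem_Ico, Finset.mem_insert, Finset.mem_Icc]; omega
    rw [hsplit, Finset.sum_insert (by simp)]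
    simp only [zero_add, pow_zero, Nat.cast_zero, div_zero, mul_one]
    refine Finset.sum_congr rfl fun n _ ↦ ?_
    have e : ((-1 : ℂ)) ^ (n + 1) * ((-1) ^ n * (I * (t : ℂ)) ^ n) = -((I * (t : ℂ)) ^ n) := by
      rw [pow_succ, show ((-1 : ℂ)) ^ n * (-1) * ((-1) ^ n * (I * (t : ℂ)) ^ n)
          = ((-1) ^ n * (-1) ^ n) * (-1) * (I * (t : ℂ)) ^ n by ring, ← mul_pow, neg_one_mul, neg_neg, one_pow]
      ring
    rw [neg_pow (I * (t : ℂ)) n, e, neg_div]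
  rw [show (1 : ℂ) - I * t = 1 + -(I * (t : ℂ)) by ring]
  rw [hT, sub_neg_eq_add] at h
  calc ‖Complex.log (1 + -(I * (t : ℂ))) + ∑ n ∈ Finset.Icc 1 K, (I * t) ^ n / (n : ℂ)‖
      ≤ t ^ (K + 1) * (1 - t)⁻¹ / (K + 1) := h
    _ = t ^ (K + 1) / ((K + 1) * (1 - t)) := by
        rw [div_eq_mul_inv, div_eq_mul_inv, mul_inv]; ring

/-! ## 1. `Log(¼ + iω/2)` from `log(ω/2)` and the logarithmic series -/

/-- State machine for `Σ_n (it)ⁿ/n`: `pow ∋ (it)^j`, `acc` = the partial sum below `j`. [folklore] -/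
def itSeries (S : ℕ) (T : MI) : ℕ → ℕ → MC → MC → MC × MC
  | 0, _, pow, acc => (pow, acc)
  | n + 1, j, pow, acc => itSeries S T n (j + 1) ((pow.mulMI S T).mulI) (acc.add (pow.divNat j))

/-- Invariant of `itSeries`. [folklore] -/
private theorem itSeries_spec (hS : 0 < S) {t : ℝ} {T : MI} (ht : MI.mem S t T) :
    ∀ (n j : ℕ) {pow acc : MC} {c : ℂ}, 0 < j → MC.mem S ((I * t) ^ j) pow → MC.mem S c acc →
      MC.mem S ((I * t) ^ (j + n)) (itSeries S T n j pow acc).1 ∧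
        MC.mem S (c + ∑ i ∈ Finset.range n, (I * t) ^ (j + i) / ((j + i : ℕ) : ℂ)) (itSeries S T n j pow acc).2
  | 0, j, pow, acc, c, _, hp, hc => by simpa [itSeries] using And.intro hp hc
  | n + 1, j, pow, acc, c, hj, hp, hc => by
      have hp' : MC.mem S ((I * t) ^ (j + 1)) ((pow.mulMI S T).mulI) := by
        have h := MC.mem_mulI (MC.mem_mulMI hS hp ht)
        convert h using 1
        rw [pow_succ]; ring
      have hc' : MC.mem S (c + (I * t) ^ j / ((j : ℕ) : ℂ)) (acc.add (pow.divNat j)) :=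
        MC.mem_add hc (MC.mem_divNat hp hj)
      have ih := itSeries_spec hS ht n (j + 1) (by omega) hp' hc'
      simp only [itSeries]
      refine ⟨by rw [show j + (n + 1) = j + 1 + n by ring]; exact ih.1, ?_⟩
      have e : c + ∑ i ∈ Finset.range (n + 1), (I * (t : ℂ)) ^ (j + i) / ((j + i : ℕ) : ℂ)
          = (c + (I * (t : ℂ)) ^ j / ((j : ℕ) : ℂ)) +
              ∑ i ∈ Finset.range n, (I * (t : ℂ)) ^ (j + 1 + i) / ((j + 1 + i : ℕ) : ℂ) := by
        rw [Finset.sum_range_succ']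
        simp only [add_zero]
        rw [Finset.sum_congr rfl fun i _ ↦ by rw [show j + (i + 1) = j + 1 + i by ring]]
        ring
      rw [e]
      exact ih.2

/-- **`Log(¼ + iω/2)`** for `ω > 0` large: `log(ω/2) + iπ/2 − Σ_{n=1}^{K} (it)ⁿ/n`, `t = 1/(2ω) ≤ ½`, widened by
`2t^{K+1}/(K+1) ≥ t^{K+1}/((K+1)(1−t))`; inputs: `om ∋ ω`, `LY ∋ log(ω/2)`, `Ph ∋ π/2`. [cite: Moore1966, Ch. 4] -/
def logQuarter (S K : ℕ) (om LY Ph : MI) : Option MC :=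
  match MI.divPos S (MI.ofInt S 1) (om.mulInt 2) with
  | none => none
  | some T =>
    if 0 ≤ T.lo ∧ 2 * T.hi ≤ S then
      let p := itSeries S T K 1 ⟨MI.ofInt S 0, T⟩ (MC.ofInt S 0)
      some ((⟨LY.sub p.2.re, Ph.sub p.2.im⟩ : MC).widen (Numerics.cdiv (2 * p.1.absHi) (K + 1)))
    else none

/-- **`logQuarter ∋ Log(¼ + iω/2)`.** [cite: Moore1966, Ch. 4] -/
theorem mem_logQuarter (hS : 0 < S) {K : ℕ} {ω : ℝ} (hω : 0 < ω) {om LY Ph : MI} (hom : MI.mem S ω om)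
    (hLY : MI.mem S (Real.log (ω / 2)) LY) (hPh : MI.mem S (Real.pi / 2) Ph) {L : MC}
    (h : logQuarter S K om LY Ph = some L) : MC.mem S (Complex.log (1 / 4 + (ω : ℂ) / 2 * I)) L := by
  have hSr : (0 : ℝ) < S := by exact_mod_cast hS
  unfold logQuarter at h
  rcases hT : MI.divPos S (MI.ofInt S 1) (om.mulInt 2) with _ | T
  · simp [hT] at h
  · simp only [hT] at h
    split_ifs at h with hg
    obtain ⟨hT0, hT2⟩ := hg
    simp only [Option.some.injEq] at h
    subst h
    -- `t = 1/(2ω) ∈ T`, `0 ≤ t ≤ 1/2`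
    set t : ℝ := 1 / (2 * ω) with ht_def
    have ht : MI.mem S t T := by
      have h1 := MI.mem_divPos hS hT (MI.mem_ofInt S 1) (MI.mem_mulInt hom 2)
      convert h1 using 1
      rw [ht_def]; push_cast; ring
    have ht0 : 0 ≤ t := by rw [ht_def]; positivity
    have hthalf : t ≤ 1 / 2 := by
      have h2 : t * S ≤ (T.hi : ℝ) := ht.2
      have h3 : (2 : ℝ) * T.hi ≤ S := by exact_mod_cast hT2
      nlinarith
    have ht1 : t < 1 := by linarith
    -- the series
    have hp0 : MC.mem S ((I * t) ^ 1) (⟨MI.ofInt S 0, T⟩ : MC) := by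
      refine ⟨?_, ?_⟩
      · simpa using MI.mem_ofInt S 0
      · simpa using ht
    have hc0 : MC.mem S (((0 : ℤ) : ℂ)) (MC.ofInt S 0) := MC.mem_ofInt S 0
    have hser := itSeries_spec hS ht K 1 one_pos hp0 hc0
    set p := itSeries S T K 1 ⟨MI.ofInt S 0, T⟩ (MC.ofInt S 0) with hp_def
    set A : ℂ := ∑ n ∈ Finset.Icc 1 K, (I * (t : ℂ)) ^ n / (n : ℂ) with hA
    have hA' : ((0 : ℤ) : ℂ) + ∑ i ∈ Finset.range K, (I * (t : ℂ)) ^ (1 + i) / ((1 + i : ℕ) : ℂ) = A := by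
      rw [hA, Int.cast_zero, zero_add, ← Finset.Ico_add_one_right_eq_Icc, Finset.sum_Ico_eq_sum_range,
        show K + 1 - 1 = K by omega]
    have hacc : MC.mem S A p.2 := hA' ▸ hser.2
    have hpow : MC.mem S ((I * (t : ℂ)) ^ (K + 1)) p.1 := by rw [add_comm]; exact hser.1
    -- the main term `M = log(ω/2) + iπ/2 − A`
    set M : ℂ := (Real.log (ω / 2) : ℂ) + ((Real.pi / 2 : ℝ) : ℂ) * I - A with hM
    have hMbox : MC.mem S M (⟨LY.sub p.2.re, Ph.sub p.2.im⟩ : MC) := by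
      refine ⟨?_, ?_⟩
      · have e : M.re = Real.log (ω / 2) - A.re := by simp [hM]
        rw [e]; exact MI.mem_sub hLY hacc.1
      · have e : M.im = Real.pi / 2 - A.im := by simp [hM]
        rw [e]; exact MI.mem_sub hPh hacc.2
    -- `Log w = M + r`, `‖r‖ ≤ 2t^{K+1}/(K+1)`
    have hy : (0 : ℝ) < ω / 2 := by positivity
    have hlog := log_quarter_add_mul_I' hy
    have ew : (1 / 4 + ((ω / 2 : ℝ) : ℂ) * I) = 1 / 4 + (ω : ℂ) / 2 * I := by push_cast; ring
    have et : (1 / (4 * (ω / 2)) : ℝ) = t := by rw [ht_def]; ring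
    rw [ew, et] at hlog
    have hrem := norm_log_one_sub_add_sum_le' ht0 ht1 K
    apply MC.mem_widen hMbox
    -- ‖Log w − M‖·S ≤ e
    have hdiff : Complex.log (1 / 4 + (ω : ℂ) / 2 * I) - M = Complex.log (1 - I * (t : ℂ)) + A := by
      rw [hlog, hM]; ring
    rw [hdiff]
    have hK1 : (0 : ℝ) < (K : ℝ) + 1 := by positivity
    have hr2 : t ^ (K + 1) / ((K + 1) * (1 - t)) ≤ 2 * t ^ (K + 1) / (K + 1) := by
      rw [div_le_div_iff₀ (mul_pos hK1 (by linarith)) hK1]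
      have h1 : (1 : ℝ) ≤ 2 * (1 - t) := by linarith
      have h2 : 0 ≤ t ^ (K + 1) * (K + 1) := by positivity
      calc t ^ (K + 1) * ((K : ℝ) + 1) = t ^ (K + 1) * (K + 1) * 1 := by ring
        _ ≤ t ^ (K + 1) * (K + 1) * (2 * (1 - t)) := mul_le_mul_of_nonneg_left h1 h2
        _ = 2 * t ^ (K + 1) * ((K + 1) * (1 - t)) := by ring
    have hnorm : ‖(I * (t : ℂ)) ^ (K + 1)‖ = t ^ (K + 1) := by
      rw [norm_pow, norm_mul, Complex.norm_I, one_mul, Complex.norm_real, Real.norm_of_nonneg ht0]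
    have habs : t ^ (K + 1) * S ≤ (p.1.absHi : ℝ) := by rw [← hnorm]; exact MC.norm_le_absHi hpow
    have hcd := Numerics.div_le_cdiv (a := 2 * p.1.absHi) (b := (K : ℤ) + 1) (by omega)
    calc ‖Complex.log (1 - I * (t : ℂ)) + A‖ * S ≤ 2 * t ^ (K + 1) / (K + 1) * S :=
          mul_le_mul_of_nonneg_right (hrem.trans hr2) hSr.le
      _ = 2 * (t ^ (K + 1) * S) / (K + 1) := by ring
      _ ≤ 2 * (p.1.absHi : ℝ) / (K + 1) := by gcongr
      _ ≤ ((Numerics.cdiv (2 * p.1.absHi) ((K : ℤ) + 1) : ℤ) : ℝ) := by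
          refine le_trans (le_of_eq ?_) hcd
          push_cast; ring

/-! ## 2. `ψ(¼ + iω/2)` by the unshifted Stirling series -/

/-- Scaled majorant `⌈S·(40/3)(2ν+1)!/(6^{2ν+1}(omlo/2S)^{2ν})⌉` of the Stirling remainder at `w = ¼ + iy`,
`y ≥ omlo/(2S) > 0` (`π² ≤ 10`, `2π ≥ 6`, `Re w = ¼`, `|w| ≥ y`). [cite: AndrewsAskeyRoy1999, Cor 1.4.5] -/
def remQ (S ν : ℕ) (omlo : ℤ) : ℤ :=
  ⌈(S : ℚ) * ((40 / 3 : ℚ) * ((2 * ν + 1).factorial : ℚ) /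
      ((6 : ℚ) ^ (2 * ν + 1) * ((omlo : ℚ) / (2 * (S : ℚ))) ^ (2 * ν)))⌉

/-- **Enclosure of `ψ(¼ + iω/2)`** (`om ∋ ω` with `om.lo > 0`, `LY ∋ log(ω/2)`, `P ∋ π`, Bernoulli list `cs`): the
unshifted Stirling series `Log w − 1/(2w) − Σ_{k≤ν} B_{2k}/(2k w^{2k})` widened by `remQ`. [cite: AndrewsAskeyRoy1999, Cor 1.4.5] -/
def digammaQuarterFast (S K : ℕ) (cs : List ℚ) (P om LY : MI) : Option MC :=
  if 0 < om.lo then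
    match logQuarter S K om LY (P.divNat 2), MC.divBox S (MC.ofInt S 1) (quarterBox S om) with
    | some L, some J =>
        some ((((L.sub (J.divNat 2)).sub (MC.bernSeries S (J.sqr S) cs 1 (J.sqr S) (MC.ofInt S 0)))).widen
          (remQ S cs.length om.lo))
    | _, _ => none
  else none

/-- **`digammaQuarterFast ∋ ψ(¼ + iω/2)`.** [cite: AndrewsAskeyRoy1999, Cor 1.4.5] -/
theorem mem_digammaQuarterFast (hS : 0 < S) {K : ℕ} {cs : List ℚ} (hcs0 : cs ≠ [])
    (hcs : ∀ k < cs.length, ((cs.getD k 0 : ℚ) : ℂ) = (bernoulli (2 * (k + 1)) : ℂ))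
    {P om LY : MI} {ω : ℝ} (hpi : MI.mem S Real.pi P) (hom : MI.mem S ω om)
    (hLY : MI.mem S (Real.log (ω / 2)) LY) {Y : MC} (h : digammaQuarterFast S K cs P om LY = some Y) :
    MC.mem S (Complex.digamma (1 / 4 + (ω : ℂ) / 2 * I)) Y := by
  have hSr : (0 : ℝ) < S := by exact_mod_cast hS
  unfold digammaQuarterFast at h
  split_ifs at h with hlo
  split at h
  · rename_i L J hL hJ
    simp only [Option.some.injEq] at h
    subst h
    have hω : 0 < ω := MI.pos_of_lo_pos hom hlo
    set w : ℂ := 1 / 4 + (ω : ℂ) / 2 * I with hw_def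
    have hwre : w.re = 1 / 4 := by simp [hw_def]
    have hwim : w.im = ω / 2 := by simp [hw_def]
    have hwre0 : 0 < w.re := by rw [hwre]; norm_num
    have hW : MC.mem S w (quarterBox S om) := mem_quarterBox hom
    have hPh : MI.mem S (Real.pi / 2) (P.divNat 2) := by simpa using MI.mem_divNat hpi (n := 2) two_pos
    have hL' := mem_logQuarter hS hω hom hLY hPh hL
    have hJ' : MC.mem S (w⁻¹) J := by
      have := MC.mem_divBox hS hJ (MC.mem_ofInt S 1) hW
      push_cast at this
      rwa [one_div] at this
    have hU : MC.mem S ((w⁻¹) ^ 2) (J.sqr S) := MC.mem_sqr hS hJ'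
    have hB := MC.mem_bernSeries hS hU cs 1 one_pos (by rw [pow_one]; exact hU) (MC.mem_ofInt S 0)
    have hmain := MC.mem_sub (MC.mem_sub hL' (MC.mem_divNat hJ' (n := 2) two_pos)) hB
    set ν := cs.length with hν
    have hν0 : ν ≠ 0 := fun h0 ↦ hcs0 (List.eq_nil_of_length_eq_zero h0)
    have ebern : (((0 : ℤ) : ℂ) + ∑ i ∈ Finset.range ν,
          ((cs.getD i 0 : ℚ) : ℂ) / (2 * ((1 + i : ℕ) : ℂ)) * (((w⁻¹) ^ 2) ^ (1 + i))) =
        ∑ k ∈ Finset.Icc 1 ν, (bernoulli (2 * k) : ℂ) / (2 * k) / w ^ (2 * k) := by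
      rw [Int.cast_zero, zero_add, ← Finset.Ico_add_one_right_eq_Icc, Finset.sum_Ico_eq_sum_range,
        show ν + 1 - 1 = ν by omega]
      refine Finset.sum_congr rfl fun i hi ↦ ?_
      rw [Finset.mem_range] at hi
      have hc := hcs i hi
      rw [show 1 + i = i + 1 by ring] at *
      rw [hc, ← pow_mul, inv_pow]
      push_cast
      ring
    have hmain' : MC.mem S (Complex.log w - 1 / (2 * w) -
        ∑ k ∈ Finset.Icc 1 ν, (bernoulli (2 * k) : ℂ) / (2 * k) / w ^ (2 * k))
        (((L.sub (J.divNat 2)).sub (MC.bernSeries S (J.sqr S) cs 1 (J.sqr S) (MC.ofInt S 0)))) := by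
      convert hmain using 2
      · push_cast; rw [one_div, mul_inv]; ring
      · exact ebern.symm
    have hrem := Literature.Analysis.SpecialFunctions.Complex.norm_digamma_sub_stirlingSeries_le hwre0 hν0
    apply MC.mem_widen hmain'
    -- the remainder: ‖w‖ ≥ ω/2 ≥ om.lo/(2S) =: ρ₀
    set ρ₀ : ℝ := (om.lo : ℝ) / (2 * S) with hρ₀
    have hρ₀pos : 0 < ρ₀ := by
      have : (0 : ℝ) < om.lo := by exact_mod_cast hlo
      rw [hρ₀]; positivity
    have hρ₀le : ρ₀ ≤ ‖w‖ := by
      have h1 : (om.lo : ℝ) ≤ ω * S := hom.1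
      have h2 : ρ₀ ≤ ω / 2 := by
        rw [hρ₀, div_le_div_iff₀ (by positivity) (by norm_num)]; nlinarith
      have h3 : |w.im| ≤ ‖w‖ := Complex.abs_im_le_norm w
      rw [hwim, abs_of_pos (by positivity)] at h3
      exact h2.trans h3
    have hden : ρ₀ ^ (2 * ν) * (1 / 4) ≤ ‖w‖ ^ (2 * ν) * w.re := by
      rw [hwre]
      exact mul_le_mul_of_nonneg_right (pow_le_pow_left₀ hρ₀pos.le hρ₀le _) (by norm_num)
    have hpi10 : Real.pi ^ 2 ≤ 10 := by nlinarith [Real.pi_pos, Real.pi_lt_d2]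
    have hsix : (6 : ℝ) ≤ 2 * Real.pi := by linarith [Real.pi_gt_three]
    have hF : (0 : ℝ) < ((2 * ν + 1).factorial : ℝ) := by positivity
    have hrp : 0 < ρ₀ ^ (2 * ν) * (1 / 4) := by positivity
    have h6p : (0 : ℝ) < (6 : ℝ) ^ (2 * ν + 1) := by positivity
    have hpow : (6 : ℝ) ^ (2 * ν + 1) ≤ (2 * Real.pi) ^ (2 * ν + 1) := pow_le_pow_left₀ (by norm_num) hsix _
    have hA : Real.pi ^ 2 / 3 * ((2 * ν + 1).factorial : ℝ) / (2 * Real.pi) ^ (2 * ν + 1)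
        ≤ 10 / 3 * ((2 * ν + 1).factorial : ℝ) / (6 : ℝ) ^ (2 * ν + 1) := by
      rw [div_le_div_iff₀ (by positivity) h6p]
      calc Real.pi ^ 2 / 3 * ((2 * ν + 1).factorial : ℝ) * (6 : ℝ) ^ (2 * ν + 1)
          ≤ 10 / 3 * ((2 * ν + 1).factorial : ℝ) * (6 : ℝ) ^ (2 * ν + 1) := by
            apply mul_le_mul_of_nonneg_right _ h6p.le
            exact mul_le_mul_of_nonneg_right (by linarith) hF.le
        _ ≤ 10 / 3 * ((2 * ν + 1).factorial : ℝ) * (2 * Real.pi) ^ (2 * ν + 1) :=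
            mul_le_mul_of_nonneg_left hpow (by positivity)
    have hR : Real.pi ^ 2 / 3 * ((2 * ν + 1).factorial : ℝ) / (2 * Real.pi) ^ (2 * ν + 1) /
          (‖w‖ ^ (2 * ν) * w.re)
        ≤ 10 / 3 * ((2 * ν + 1).factorial : ℝ) / (6 : ℝ) ^ (2 * ν + 1) / (ρ₀ ^ (2 * ν) * (1 / 4)) := by
      rw [div_le_div_iff₀ (lt_of_lt_of_le hrp hden) hrp]
      calc Real.pi ^ 2 / 3 * ((2 * ν + 1).factorial : ℝ) / (2 * Real.pi) ^ (2 * ν + 1) * (ρ₀ ^ (2 * ν) * (1 / 4))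
          ≤ 10 / 3 * ((2 * ν + 1).factorial : ℝ) / (6 : ℝ) ^ (2 * ν + 1) * (ρ₀ ^ (2 * ν) * (1 / 4)) :=
            mul_le_mul_of_nonneg_right hA hrp.le
        _ ≤ 10 / 3 * ((2 * ν + 1).factorial : ℝ) / (6 : ℝ) ^ (2 * ν + 1) * (‖w‖ ^ (2 * ν) * w.re) :=
            mul_le_mul_of_nonneg_left hden (by positivity)
    have hceil : (S : ℝ) * (10 / 3 * ((2 * ν + 1).factorial : ℝ) / (6 : ℝ) ^ (2 * ν + 1) / (ρ₀ ^ (2 * ν) * (1 / 4)))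
        ≤ (remQ S ν om.lo : ℝ) := by
      have hq := Int.le_ceil ((S : ℚ) * ((40 / 3 : ℚ) * ((2 * ν + 1).factorial : ℚ) /
        ((6 : ℚ) ^ (2 * ν + 1) * ((om.lo : ℚ) / (2 * (S : ℚ))) ^ (2 * ν))))
      have hq' := (Rat.cast_le (K := ℝ)).2 hq
      unfold remQ
      rw [Rat.cast_intCast] at hq'
      refine le_trans (le_of_eq ?_) hq'
      rw [hρ₀]
      push_cast
      field_simp
      ring
    calc ‖Complex.digamma w - (Complex.log w - 1 / (2 * w) -
          ∑ k ∈ Finset.Icc 1 ν, (bernoulli (2 * k) : ℂ) / (2 * k) / w ^ (2 * k))‖ * S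
        ≤ Real.pi ^ 2 / 3 * ((2 * ν + 1).factorial : ℝ) / (2 * Real.pi) ^ (2 * ν + 1) /
            (‖w‖ ^ (2 * ν) * w.re) * S := mul_le_mul_of_nonneg_right hrem hSr.le
      _ ≤ 10 / 3 * ((2 * ν + 1).factorial : ℝ) / (6 : ℝ) ^ (2 * ν + 1) / (ρ₀ ^ (2 * ν) * (1 / 4)) * S :=
          mul_le_mul_of_nonneg_right hR hSr.le
      _ = (S : ℝ) * (10 / 3 * ((2 * ν + 1).factorial : ℝ) / (6 : ℝ) ^ (2 * ν + 1) / (ρ₀ ^ (2 * ν) * (1 / 4))) := by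
          ring
      _ ≤ (remQ S ν om.lo : ℝ) := hceil
  · simp at h

/-! ## 3. Unit-circle balls (midpoint–radius form) for the phases -/

/-- A scaled complex ball: `‖z·S − (cre + i·cim)‖ ≤ r`. [cite: Moore1966, Ch. 3] -/
structure Ball where
  /-- real part of the centre (scale `S`) -/
  cre : ℤ
  /-- imaginary part of the centre (scale `S`) -/
  cim : ℤ
  /-- radius (scale `S`) -/
  r : ℕ
  deriving Repr, Inhabited

/-- Membership in a ball. [cite: Moore1966, Ch. 3] -/
def Ball.mem (S : ℕ) (z : ℂ) (b : Ball) : Prop := ‖z * (S : ℂ) - ((b.cre : ℂ) + (b.cim : ℂ) * I)‖ ≤ (b.r : ℝ)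

/-- Product of two balls of points of modulus `≤ 1` (centre rounded, radius `((S+r_A)r_B + S r_A)/S + 3`). [cite: Moore1966, Ch. 3] -/
def Ball.mul (S : ℕ) (A B : Ball) : Ball :=
  ⟨(A.cre * B.cre - A.cim * B.cim) / S, (A.cre * B.cim + A.cim * B.cre) / S,
   (((S : ℕ) + A.r) * B.r + S * A.r) / S + 3⟩

/-- The box of a ball widened by `w` (scaled). [cite: Moore1966, Ch. 3] -/
def Ball.toMC (b : Ball) (w : ℤ) : MC :=
  ⟨⟨b.cre - b.r - w, b.cre + b.r + w⟩, ⟨b.cim - b.r - w, b.cim + b.r + w⟩⟩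

/-- A ball containing a box (centre = midpoints, radius = sum of the half-widths + 4). [cite: Moore1966, Ch. 3] -/
def Ball.ofMC (Z : MC) : Ball :=
  ⟨(Z.re.lo + Z.re.hi) / 2, (Z.im.lo + Z.im.hi) / 2,
   ((Z.re.hi - Z.re.lo) / 2 + (Z.im.hi - Z.im.lo) / 2 + 4).toNat⟩

/-- `|p/S − ⌊p/S⌋| ≤ 1` for integer division. [folklore] -/
private theorem abs_ediv_sub_le_one (hS : 0 < S) (p : ℤ) : |((p / (S : ℤ) : ℤ) : ℝ) - (p : ℝ) / S| ≤ 1 := by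
  have hSz : (0 : ℤ) < S := by exact_mod_cast hS
  have hSr : (0 : ℝ) < S := by exact_mod_cast hS
  have h1 := Int.emod_add_mul_ediv p (S : ℤ)
  have h2 := Int.emod_nonneg p hSz.ne'
  have h3 := Int.emod_lt_of_pos p hSz
  have e : (p : ℝ) / S = ((p / (S : ℤ) : ℤ) : ℝ) + ((p % (S : ℤ) : ℤ) : ℝ) / S := by
    have : (p : ℝ) = ((p % (S : ℤ) : ℤ) : ℝ) + (S : ℝ) * ((p / (S : ℤ) : ℤ) : ℝ) := by exact_mod_cast h1.symm
    rw [this]; field_simp; ring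
  rw [e, abs_le]
  have h4 : (0 : ℝ) ≤ ((p % (S : ℤ) : ℤ) : ℝ) / S := by positivity
  have h5 : ((p % (S : ℤ) : ℤ) : ℝ) / S ≤ 1 := by
    rw [div_le_one hSr]; exact_mod_cast h3.le
  constructor <;> linarith

/-- `x/S ≤ ⌊x/S⌋ + 1` for natural division. [folklore] -/
private theorem div_le_nat_div_add_one (hS : 0 < S) (x : ℕ) : (x : ℝ) / S ≤ ((x / S : ℕ) : ℝ) + 1 := by
  have hSr : (0 : ℝ) < S := by exact_mod_cast hS
  rw [div_le_iff₀ hSr]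
  have h := Nat.lt_succ_iff.2 (le_refl (x / S))
  have h2 : x < (x / S + 1) * S := by
    have := Nat.div_add_mod x S
    have hm := Nat.mod_lt x hS
    nlinarith
  have h3 : (x : ℝ) ≤ ((x / S : ℕ) : ℝ) * S + S := by
    have : (x : ℝ) < (((x / S : ℕ) + 1 : ℕ) : ℝ) * S := by exact_mod_cast h2
    push_cast at this; linarith
  linarith

/-- **Product of balls**: `z ∈ A`, `w ∈ B`, `‖z‖, ‖w‖ ≤ 1` ⟹ `zw ∈ A·B`. [cite: Moore1966, Ch. 3] -/
theorem Ball.mem_mul (hS : 0 < S) {z w : ℂ} {A B : Ball} (hz : A.mem S z) (hw : B.mem S w)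
    (hz1 : ‖z‖ ≤ 1) (hw1 : ‖w‖ ≤ 1) : (A.mul S B).mem S (z * w) := by
  have hSr : (0 : ℝ) < S := by exact_mod_cast hS
  unfold Ball.mem at hz hw ⊢
  set cA : ℂ := (A.cre : ℂ) + (A.cim : ℂ) * I with hcA
  set cB : ℂ := (B.cre : ℂ) + (B.cim : ℂ) * I with hcB
  set δA : ℂ := z * S - cA with hδA
  set δB : ℂ := w * S - cB with hδB
  -- exact product of the centres and its rounding
  set P : ℂ := cA * cB with hP
  have hPre : P.re = ((A.cre * B.cre - A.cim * B.cim : ℤ) : ℝ) := by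
    simp [hP, hcA, hcB]
  have hPim : P.im = ((A.cre * B.cim + A.cim * B.cre : ℤ) : ℝ) := by
    simp [hP, hcA, hcB]
  set c' : ℂ := (((A.cre * B.cre - A.cim * B.cim) / (S : ℤ) : ℤ) : ℂ) +
      (((A.cre * B.cim + A.cim * B.cre) / (S : ℤ) : ℤ) : ℂ) * I with hc'
  have hround : ‖P / S - c'‖ ≤ 2 := by
    have hre : |(P / S - c').re| ≤ 1 := by
      have e : (P / S - c').re = P.re / S - (((A.cre * B.cre - A.cim * B.cim) / (S : ℤ) : ℤ) : ℝ) := by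
        simp [hc', Complex.div_natCast_re]
      rw [e, hPre, abs_sub_comm]
      exact abs_ediv_sub_le_one hS _
    have him : |(P / S - c').im| ≤ 1 := by
      have e : (P / S - c').im = P.im / S - (((A.cre * B.cim + A.cim * B.cre) / (S : ℤ) : ℤ) : ℝ) := by
        simp [hc', Complex.div_natCast_im]
      rw [e, hPim, abs_sub_comm]
      exact abs_ediv_sub_le_one hS _
    calc ‖P / S - c'‖ ≤ |(P / S - c').re| + |(P / S - c').im| := Complex.norm_le_abs_re_add_abs_im _
      _ ≤ 1 + 1 := add_le_add hre him
      _ = 2 := by norm_num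
  -- the algebra: `zw·S = P/S + (cA·δB + δA·(w S))/S`
  have hz' : z * S = cA + δA := by rw [hδA]; ring
  have hw' : w * S = cB + δB := by rw [hδB]; ring
  have hSne : (S : ℂ) ≠ 0 := by exact_mod_cast hS.ne'
  have halg : z * w * (S : ℂ) - c' = (P / S - c') + (cA * δB + δA * (w * S)) / S := by
    rw [hP, hδA, hδB]
    field_simp
    ring
  have hcA_le : ‖cA‖ ≤ S + A.r := by
    have : cA = z * S - δA := by rw [hδA]; ring
    rw [this]
    calc ‖z * ↑S - δA‖ ≤ ‖z * ↑S‖ + ‖δA‖ := norm_sub_le _ _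
      _ ≤ S + A.r := by
          refine add_le_add ?_ hz
          rw [norm_mul, Complex.norm_natCast]
          calc ‖z‖ * S ≤ 1 * S := mul_le_mul_of_nonneg_right hz1 hSr.le
            _ = S := one_mul _
  have hwS : ‖w * (S : ℂ)‖ ≤ S := by
    rw [norm_mul, Complex.norm_natCast]
    calc ‖w‖ * S ≤ 1 * S := mul_le_mul_of_nonneg_right hw1 hSr.le
      _ = S := one_mul _
  have hnum : ‖cA * δB + δA * (w * S)‖ ≤ (S + A.r) * B.r + A.r * S := by
    calc ‖cA * δB + δA * (w * S)‖ ≤ ‖cA * δB‖ + ‖δA * (w * S)‖ := norm_add_le _ _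
      _ = ‖cA‖ * ‖δB‖ + ‖δA‖ * ‖w * S‖ := by rw [norm_mul, norm_mul]
      _ ≤ (S + A.r) * B.r + A.r * S := by
          refine add_le_add ?_ ?_
          · exact mul_le_mul hcA_le hw (norm_nonneg _) (by positivity)
          · exact mul_le_mul hz hwS (norm_nonneg _) (by positivity)
  have hfloor := div_le_nat_div_add_one hS (((S : ℕ) + A.r) * B.r + S * A.r)
  have hrad : ((S + A.r) * B.r + A.r * S : ℝ) / S + 2 ≤ (((((S : ℕ) + A.r) * B.r + S * A.r) / S + 3 : ℕ) : ℝ) := by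
    push_cast at hfloor ⊢
    have e : ((S : ℝ) + A.r) * B.r + A.r * S = ((S : ℝ) + A.r) * B.r + S * A.r := by ring
    rw [e]
    linarith
  show ‖z * w * ↑S - c'‖ ≤ _
  -- `c'` is literally the centre of `A.mul S B`
  have ec : ((((A.mul S B).cre : ℤ) : ℂ) + (((A.mul S B).cim : ℤ) : ℂ) * I) = c' := by simp [Ball.mul, hc']
  rw [halg]
  calc ‖P / ↑S - c' + (cA * δB + δA * (w * ↑S)) / ↑S‖ ≤ ‖P / ↑S - c'‖ + ‖(cA * δB + δA * (w * ↑S)) / ↑S‖ :=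
        norm_add_le _ _
    _ ≤ 2 + ((S + A.r) * B.r + A.r * S) / S := by
        refine add_le_add hround ?_
        rw [norm_div, Complex.norm_natCast, div_le_div_iff_of_pos_right hSr]
        exact hnum
    _ ≤ (((A.mul S B).r : ℕ) : ℝ) := by
        have : (A.mul S B).r = (((S : ℕ) + A.r) * B.r + S * A.r) / S + 3 := rfl
        rw [this]; linarith

/-- **From a ball to a box**: `u ∈ b`, `‖z − u‖·S ≤ w` ⟹ `z ∈ b.toMC w`. [cite: Moore1966, Ch. 3] -/
theorem Ball.memMC_toMC {u z : ℂ} {b : Ball} {w : ℤ} (hb : b.mem S u) (hzu : ‖z - u‖ * S ≤ (w : ℝ)) :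
    MC.mem S z (b.toMC w) := by
  unfold Ball.mem at hb
  have htot : ‖z * (S : ℂ) - ((b.cre : ℂ) + (b.cim : ℂ) * I)‖ ≤ b.r + w := by
    have e : z * (S : ℂ) - ((b.cre : ℂ) + (b.cim : ℂ) * I) = (z - u) * S + (u * S - ((b.cre : ℂ) + (b.cim : ℂ) * I)) := by
      ring
    rw [e]
    calc ‖(z - u) * ↑S + (u * ↑S - (↑b.cre + ↑b.cim * I))‖ ≤ ‖(z - u) * ↑S‖ + ‖u * ↑S - (↑b.cre + ↑b.cim * I)‖ :=
          norm_add_le _ _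
      _ ≤ w + b.r := by
          refine add_le_add ?_ hb
          rw [norm_mul, Complex.norm_natCast]; exact hzu
      _ = b.r + w := add_comm _ _
  have hre := (Complex.abs_re_le_norm _).trans htot
  have him := (Complex.abs_im_le_norm _).trans htot
  simp only [Complex.sub_re, Complex.mul_re, Complex.natCast_re, Complex.natCast_im, mul_zero, sub_zero,
    Complex.add_re, Complex.intCast_re, Complex.mul_im, Complex.I_re, Complex.intCast_im, Complex.I_im,
    mul_one, zero_add, add_zero, Complex.sub_im, Complex.add_im] at hre him
  rw [abs_le] at hre him
  refine ⟨⟨?_, ?_⟩, ⟨?_, ?_⟩⟩ <;> simp only [Ball.toMC] <;> push_cast <;> linarith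

/-- **From a box to a ball.** [cite: Moore1966, Ch. 3] -/
theorem Ball.mem_ofMC {z : ℂ} {Z : MC} (hz : MC.mem S z Z) : (Ball.ofMC Z).mem S z := by
  obtain ⟨⟨h1, h2⟩, ⟨h3, h4⟩⟩ := hz
  unfold Ball.mem Ball.ofMC
  simp only
  have hre : |(z * (S : ℂ) - ((((Z.re.lo + Z.re.hi) / 2 : ℤ) : ℂ) + (((Z.im.lo + Z.im.hi) / 2 : ℤ) : ℂ) * I)).re|
      ≤ ((Z.re.hi - Z.re.lo) / 2 : ℤ) + 2 := by
    have e : (z * (S : ℂ) - ((((Z.re.lo + Z.re.hi) / 2 : ℤ) : ℂ) + (((Z.im.lo + Z.im.hi) / 2 : ℤ) : ℂ) * I)).re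
        = z.re * S - (((Z.re.lo + Z.re.hi) / 2 : ℤ) : ℝ) := by simp
    rw [e, abs_le]
    have q1 := Int.emod_add_mul_ediv (Z.re.lo + Z.re.hi) 2
    have q2 := Int.emod_nonneg (Z.re.lo + Z.re.hi) (by norm_num : (2 : ℤ) ≠ 0)
    have q3 := Int.emod_lt_of_pos (Z.re.lo + Z.re.hi) (by norm_num : (0 : ℤ) < 2)
    have q4 := Int.emod_add_mul_ediv (Z.re.hi - Z.re.lo) 2
    have q5 := Int.emod_nonneg (Z.re.hi - Z.re.lo) (by norm_num : (2 : ℤ) ≠ 0)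
    have q6 := Int.emod_lt_of_pos (Z.re.hi - Z.re.lo) (by norm_num : (0 : ℤ) < 2)
    have r1 : (((Z.re.lo + Z.re.hi) % 2 : ℤ) : ℝ) + (2 : ℝ) * (((Z.re.lo + Z.re.hi) / 2 : ℤ) : ℝ) = Z.re.lo + Z.re.hi := by
      exact_mod_cast q1
    have r2 : (((Z.re.hi - Z.re.lo) % 2 : ℤ) : ℝ) + (2 : ℝ) * (((Z.re.hi - Z.re.lo) / 2 : ℤ) : ℝ) = Z.re.hi - Z.re.lo := by
      exact_mod_cast q4
    have r3 : (0 : ℝ) ≤ (((Z.re.lo + Z.re.hi) % 2 : ℤ) : ℝ) := by exact_mod_cast q2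
    have r4 : (((Z.re.lo + Z.re.hi) % 2 : ℤ) : ℝ) < 2 := by exact_mod_cast q3
    have r5 : (0 : ℝ) ≤ (((Z.re.hi - Z.re.lo) % 2 : ℤ) : ℝ) := by exact_mod_cast q5
    have r6 : (((Z.re.hi - Z.re.lo) % 2 : ℤ) : ℝ) < 2 := by exact_mod_cast q6
    constructor <;> linarith
  have him : |(z * (S : ℂ) - ((((Z.re.lo + Z.re.hi) / 2 : ℤ) : ℂ) + (((Z.im.lo + Z.im.hi) / 2 : ℤ) : ℂ) * I)).im|
      ≤ ((Z.im.hi - Z.im.lo) / 2 : ℤ) + 2 := by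
    have e : (z * (S : ℂ) - ((((Z.re.lo + Z.re.hi) / 2 : ℤ) : ℂ) + (((Z.im.lo + Z.im.hi) / 2 : ℤ) : ℂ) * I)).im
        = z.im * S - (((Z.im.lo + Z.im.hi) / 2 : ℤ) : ℝ) := by simp
    rw [e, abs_le]
    have q1 := Int.emod_add_mul_ediv (Z.im.lo + Z.im.hi) 2
    have q2 := Int.emod_nonneg (Z.im.lo + Z.im.hi) (by norm_num : (2 : ℤ) ≠ 0)
    have q3 := Int.emod_lt_of_pos (Z.im.lo + Z.im.hi) (by norm_num : (0 : ℤ) < 2)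
    have q4 := Int.emod_add_mul_ediv (Z.im.hi - Z.im.lo) 2
    have q5 := Int.emod_nonneg (Z.im.hi - Z.im.lo) (by norm_num : (2 : ℤ) ≠ 0)
    have q6 := Int.emod_lt_of_pos (Z.im.hi - Z.im.lo) (by norm_num : (0 : ℤ) < 2)
    have r1 : (((Z.im.lo + Z.im.hi) % 2 : ℤ) : ℝ) + (2 : ℝ) * (((Z.im.lo + Z.im.hi) / 2 : ℤ) : ℝ) = Z.im.lo + Z.im.hi := by
      exact_mod_cast q1
    have r2 : (((Z.im.hi - Z.im.lo) % 2 : ℤ) : ℝ) + (2 : ℝ) * (((Z.im.hi - Z.im.lo) / 2 : ℤ) : ℝ) = Z.im.hi - Z.im.lo := by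
      exact_mod_cast q4
    have r3 : (0 : ℝ) ≤ (((Z.im.lo + Z.im.hi) % 2 : ℤ) : ℝ) := by exact_mod_cast q2
    have r4 : (((Z.im.lo + Z.im.hi) % 2 : ℤ) : ℝ) < 2 := by exact_mod_cast q3
    have r5 : (0 : ℝ) ≤ (((Z.im.hi - Z.im.lo) % 2 : ℤ) : ℝ) := by exact_mod_cast q5
    have r6 : (((Z.im.hi - Z.im.lo) % 2 : ℤ) : ℝ) < 2 := by exact_mod_cast q6
    constructor <;> linarith
  have hsum := (Complex.norm_le_abs_re_add_abs_im _).trans (add_le_add hre him)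
  refine hsum.trans ?_
  have hnn : (0 : ℤ) ≤ (Z.re.hi - Z.re.lo) / 2 + (Z.im.hi - Z.im.lo) / 2 + 4 := by
    have a1 : Z.re.lo ≤ Z.re.hi := by exact_mod_cast h1.trans h2
    have a2 : Z.im.lo ≤ Z.im.hi := by exact_mod_cast h3.trans h4
    have : 0 ≤ (Z.re.hi - Z.re.lo) / 2 := Int.ediv_nonneg (by linarith) (by norm_num)
    have : 0 ≤ (Z.im.hi - Z.im.lo) / 2 := Int.ediv_nonneg (by linarith) (by norm_num)
    linarith
  have ecast : ((((Z.re.hi - Z.re.lo) / 2 + (Z.im.hi - Z.im.lo) / 2 + 4).toNat : ℕ) : ℝ)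
      = (((Z.re.hi - Z.re.lo) / 2 + (Z.im.hi - Z.im.lo) / 2 + 4 : ℤ) : ℝ) := by
    exact_mod_cast Int.toNat_of_nonneg hnn
  rw [ecast]; push_cast; linarith

/-! ## 4. Point exponentials and the phase states -/

/-- The point value `e^{iφ/S}` as a ball at scale `S`, computed at scale `S·2^g` (`MI.piMachin`, `MC.expI`). [cite: Moore1966, Ch. 4] -/
def pointExpI (S g Kpi K k : ℕ) (φ : ℤ) : Option Ball :=
  match MI.piMachin (S * 2 ^ g) Kpi with
  | none => none
  | some P' =>
    match MC.expI (S * 2 ^ g) K k P' (MI.ofScaled (φ * 2 ^ g)) with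
    | none => none
    | some Z => some (Ball.ofMC ⟨MI.rescale (S * 2 ^ g) S Z.re, MI.rescale (S * 2 ^ g) S Z.im⟩)

/-- **`pointExpI ∋ e^{iφ/S}`.** [cite: Moore1966, Ch. 4] -/
theorem mem_pointExpI (hS : 0 < S) {g Kpi K k : ℕ} {φ : ℤ} {b : Ball} (h : pointExpI S g Kpi K k φ = some b) :
    b.mem S (Complex.exp ((((φ : ℝ) / S : ℝ) : ℂ) * I)) := by
  unfold pointExpI at h
  rcases hP : MI.piMachin (S * 2 ^ g) Kpi with _ | P'
  · simp [hP] at h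
  · simp only [hP] at h
    rcases hZ : MC.expI (S * 2 ^ g) K k P' (MI.ofScaled (φ * 2 ^ g)) with _ | Z
    · simp [hZ] at h
    · simp only [hZ, Option.some.injEq] at h
      subst h
      have hS' : 0 < S * 2 ^ g := Nat.mul_pos hS (pow_pos two_pos g)
      have hpi := MI.mem_piMachin hS' hP
      have hθ : MI.mem (S * 2 ^ g) ((φ : ℝ) / S) (MI.ofScaled (φ * 2 ^ g)) := by
        have h1 := MI.mem_ofScaled hS' (φ * 2 ^ g)
        have e : (((φ * 2 ^ g : ℤ) : ℝ)) / ((S * 2 ^ g : ℕ) : ℝ) = (φ : ℝ) / S := by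
          push_cast
          exact mul_div_mul_right _ _ (by positivity)
        rwa [e] at h1
      have hz := MC.mem_expI hS' hpi hZ hθ
      exact Ball.mem_ofMC ⟨MI.mem_rescale hS' S hz.1, MI.mem_rescale hS' S hz.2⟩

/-- Per prime power: the point ball `p ∋ e^{iφ/S}`, its phase `φ`, the rotation ball `v ∋ e^{iD/S}` and its phase step `D`.
[cite: Moore1966, Ch. 3] -/
structure PS where
  /-- `p ∋ e^{iφ/S}` -/
  p : Ball
  /-- the phase point (scaled) -/
  φ : ℤ
  /-- `v ∋ e^{iD/S}` -/
  v : Ball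
  /-- the phase increment (scaled) -/
  D : ℤ
  deriving Repr, Inhabited

/-- Validity of a phase state. [cite: Moore1966, Ch. 3] -/
def PS.valid (S : ℕ) (st : PS) : Prop :=
  st.p.mem S (Complex.exp ((((st.φ : ℝ) / S : ℝ) : ℂ) * I)) ∧ st.v.mem S (Complex.exp ((((st.D : ℝ) / S : ℝ) : ℂ) * I))

/-- One rotation: `p ← p·v`, `φ ← φ + D`. [cite: Moore1966, Ch. 3] -/
def PS.step (S : ℕ) (st : PS) : PS := { st with p := st.p.mul S st.v, φ := st.φ + st.D }

/-- The rotation preserves validity. [cite: Moore1966, Ch. 3] -/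
theorem PS.valid_step (hS : 0 < S) {st : PS} (h : st.valid S) : (st.step S).valid S := by
  refine ⟨?_, h.2⟩
  have hmul := Ball.mem_mul hS h.1 h.2 (by rw [Complex.norm_exp_ofReal_mul_I]) (by rw [Complex.norm_exp_ofReal_mul_I])
  simp only [PS.step]
  convert hmul using 2
  rw [← Complex.exp_add]
  congr 1
  push_cast
  ring

/-- Initial state for the length `L`: `D = (om₁ ⊗ L).lo`, `φ = (om₀ ⊗ L).lo`, both point values by `pointExpI`. [cite: Moore1966, Ch. 3] -/
def mkPS (S g Kpi K k : ℕ) (om1 om0 L : MI) : Option PS :=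
  match pointExpI S g Kpi K k (om1.mul S L).lo, pointExpI S g Kpi K k (om0.mul S L).lo with
  | some v, some p => some ⟨p, (om0.mul S L).lo, v, (om1.mul S L).lo⟩
  | _, _ => none

/-- `mkPS` produces valid states. [cite: Moore1966, Ch. 3] -/
theorem valid_mkPS (hS : 0 < S) {g Kpi K k : ℕ} {om1 om0 L : MI} {st : PS}
    (h : mkPS S g Kpi K k om1 om0 L = some st) : st.valid S := by
  unfold mkPS at h
  split at h
  · rename_i v p hv hp
    simp only [Option.some.injEq] at h
    subst h
    exact ⟨mem_pointExpI hS hp, mem_pointExpI hS hv⟩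
  · simp at h

/-- The phase box of the mode: the point ball widened by `max(Θ.hi − φ, φ − Θ.lo)`, `Θ = om ⊗ L`. [cite: Moore1966, Ch. 3] -/
def phaseBox (S : ℕ) (om L : MI) (st : PS) : MC :=
  st.p.toMC (max ((om.mul S L).hi - st.φ) (st.φ - (om.mul S L).lo))

/-- **`phaseBox ∋ e^{iωℓ}`** for `ω ∈ om`, `ℓ ∈ L` (`|e^{ia} − e^{ib}| ≤ |a − b|`). [cite: Moore1966, Ch. 3] -/
theorem mem_phaseBox (hS : 0 < S) {ω ℓ : ℝ} {om L : MI} (hom : MI.mem S ω om) (hL : MI.mem S ℓ L) {st : PS}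
    (hst : st.valid S) : MC.mem S (Complex.exp ((((ω * ℓ : ℝ)) : ℂ) * I)) (phaseBox S om L st) := by
  have hΘ := MI.mem_mul hS hom hL
  set Θ := om.mul S L with hΘdef
  unfold phaseBox
  refine Ball.memMC_toMC hst.1 ?_
  -- ‖e^{iθ*} − e^{iφ/S}‖ ≤ |θ* − φ/S|
  set u : ℝ := (st.φ : ℝ) / S with hu
  have hdist : ‖Complex.exp (((ω * ℓ : ℝ) : ℂ) * I) - Complex.exp (((u : ℝ) : ℂ) * I)‖ ≤ |ω * ℓ - u| := by
    have harg : ((ω * ℓ : ℝ) : ℂ) * I = ((u : ℝ) : ℂ) * I + I * ((ω * ℓ - u : ℝ) : ℂ) := by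
      push_cast; ring
    have e : Complex.exp (((ω * ℓ : ℝ) : ℂ) * I) - Complex.exp (((u : ℝ) : ℂ) * I)
        = Complex.exp (((u : ℝ) : ℂ) * I) * (Complex.exp (I * ((ω * ℓ - u : ℝ) : ℂ)) - 1) := by
      rw [mul_sub, mul_one, ← Complex.exp_add, ← harg]
    rw [e, norm_mul, Complex.norm_exp_ofReal_mul_I, one_mul]
    have h := Real.norm_exp_I_mul_ofReal_sub_one_le (x := ω * ℓ - u)
    rwa [Real.norm_eq_abs] at h
  have hSr : (0 : ℝ) < S := by exact_mod_cast hS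
  have hbound : |ω * ℓ - u| * S ≤ ((max (Θ.hi - st.φ) (st.φ - Θ.lo) : ℤ) : ℝ) := by
    have e : |ω * ℓ - u| * S = |ω * ℓ * S - st.φ| := by
      rw [show ω * ℓ * S - st.φ = (ω * ℓ - u) * S by rw [hu]; field_simp, abs_mul, abs_of_pos hSr]
    rw [e]
    obtain ⟨h1, h2⟩ := hΘ
    push_cast
    rw [abs_le]
    constructor
    · have : ((st.φ : ℝ) - Θ.lo) ≤ max ((Θ.hi : ℝ) - st.φ) ((st.φ : ℝ) - Θ.lo) := le_max_right _ _
      linarith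
    · have : ((Θ.hi : ℝ) - st.φ) ≤ max ((Θ.hi : ℝ) - st.φ) ((st.φ : ℝ) - Θ.lo) := le_max_left _ _
      linarith
  exact (mul_le_mul_of_nonneg_right hdist hSr.le).trans hbound

/-! ## 5. The record of a mode and the loop over a slice -/

/-- `getD` of a `zipWith` below both lengths. [folklore] -/
private theorem getD_zipWith {α β γ : Type} (f : α → β → γ) (da : α) (db : β) (dc : γ) :
    ∀ (as : List α) (bs : List β) (i : ℕ), i < as.length → i < bs.length →
      (List.zipWith f as bs).getD i dc = f (as.getD i da) (bs.getD i db)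
  | [], _, i, h, _ => by simp at h
  | _ :: _, [], i, _, h => by simp at h
  | a :: as, b :: bs, 0, _, _ => by simp
  | a :: as, b :: bs, i + 1, ha, hb => by
      simp only [List.zipWith_cons_cons, List.getD_cons_succ]
      exact getD_zipWith f da db dc as bs i (by simpa using ha) (by simpa using hb)

/-- **The fast light record at mode `m`** (`Lc ∋ log π − log(2a)`, `Lm ∋ log m`, phase states `ps`). [cite: Yoshida1992HermitianForms, §5 (5.16) p. 301] -/
def recFast (S K : ℕ) (C : Consts) (Lc Lm : MI) (ps : List PS) (m : ℕ) : Option IdxRec :=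
  match MI.divPos S (C.P.mulInt m) C.A with
  | none => none
  | some om =>
    match MI.divPos S (MI.ofInt S 1) ((MI.ofInt S 1).add ((om.sqr S).mulInt 4)), ssum S om (om.sqr S) 0 C.eks,
          digammaQuarterFast S K MC.bernoulliTable C.P om (Lc.add Lm) with
    | some c, some eS, some Ψ =>
        some ⟨om, c, Ψ.im, eS.widen C.tailE, List.zipWith (phaseBox S om) C.lens ps, Ψ.re,
              MI.ofInt S 0, MI.ofInt S 0⟩
    | _, _, _ => none

/-- **`recFast` is valid.** [cite: Moore1966, Ch. 3] -/
theorem colValid_of_recFast (hS : 0 < S) {a : ℝ} (ha0 : 0 < a) {ks : List PrimeLen} {C : Consts}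
    (hC : ConstsValid S a ks C) {K m : ℕ} (hm : 1 ≤ m) {Lc Lm : MI} {ps : List PS}
    (hLc : MI.mem S (Real.log Real.pi - Real.log (2 * a)) Lc) (hLm : MI.mem S (Real.log m) Lm)
    (hlen : ps.length = ks.length) (hps : ∀ i < ks.length, (ps.getD i default).valid S) {R : IdxRec}
    (h : recFast S K C Lc Lm ps m = some R) : ColValid S a ks m R := by
  unfold recFast at h
  split at h
  · simp at h
  · rename_i om hom
    split at h
    · rename_i c eS Ψ hc heS hΨ
      simp only [Option.some.injEq] at h
      subst h
      have hω : MI.mem S (freq a m) om := by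
        refine mem_of_eq (MI.mem_divPos hS hom (MI.mem_mulInt hC.pi m) hC.ha) ?_
        unfold freq; push_cast; ring
      have hω2 : MI.mem S (freq a m ^ 2) (om.sqr S) := MI.mem_sqr hS hω
      have hfreq_pos : 0 < freq a (m : ℤ) := by
        unfold freq
        have : (0 : ℝ) < (m : ℤ) := by exact_mod_cast hm
        positivity
      have hLY : MI.mem S (Real.log (freq a m / 2)) (Lc.add Lm) := by
        refine mem_of_eq (MI.mem_add hLc hLm) ?_
        have hm0 : (0 : ℝ) < m := by exact_mod_cast hm
        unfold freq
        push_cast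
        rw [show Real.pi * (m : ℝ) / a / 2 = Real.pi * m / (2 * a) by ring,
          Real.log_div (by positivity) (by positivity), Real.log_mul Real.pi_pos.ne' hm0.ne']
        ring
      have hψ := mem_digammaQuarterFast hS (by simp [MC.bernoulliTable]) (fun k hk ↦ by
        have hk' : k < 10 := by simpa [MC.bernoulliTable] using hk
        exact_mod_cast MC.bernoulliTable_getD hk') hC.pi hω hLY hΨ
      have heS' := mem_ssum (a := a) hS hω hω2 C.eks 0 (fun i hi ↦ by simpa using hC.eks i hi) heS
      simp only [Nat.zero_add] at heS'
      have htailS : |archExpSumSin a m - ∑ i ∈ Finset.range C.eks.length, sinTerm a m i| * S ≤ C.tailE :=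
        le_trans (mul_le_mul_of_nonneg_right (abs_archExpSumSin_sub_sum_le ha0 m _) (Nat.cast_nonneg _)) hC.tail
      refine ⟨{ om := hω, c := ?_, imP := hψ.2, eS := MI.mem_widen heS' htailS, cs_len := ?_, cs := ?_ }, hψ.1⟩
      · refine mem_of_eq (MI.mem_divPos hS hc (MI.mem_ofInt S 1)
          (MI.mem_add (MI.mem_ofInt S 1) (MI.mem_mulInt hω2 4))) ?_
        push_cast; ring
      · simp only [List.length_zipWith, hlen, hC.lens_len, min_self]
      · intro i hi
        simp only
        rw [getD_zipWith (phaseBox S om) default default default C.lens ps i (by rw [hC.lens_len]; exact hi)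
          (by rw [hlen]; exact hi)]
        exact mem_phaseBox hS hω (hC.lens i hi) (hps i hi)
    · simp at h

/-- **The loop** over the modes `m, m+1, …, m+k−1`: check the record against the stored one, then advance
`log m` additively (`MI.logOneSub` at `1/(m+1)`, `K₂` terms) and rotate the phases. [cite: Moore1966, Ch. 3] -/
def goFast (S K K₂ : ℕ) (C : Consts) (ctab : List IdxRec) (Lc : MI) : ℕ → ℕ → MI → List PS → Bool
  | 0, _, _, _ => true
  | k + 1, m, Lm, ps =>
    match recFast S K C Lc Lm ps m, MI.logOneSub S K₂ (MI.ofFrac S 1 (m + 1)) with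
    | some R, some l => IdxRec.withinCol R (tget ctab m) && goFast S K K₂ C ctab Lc k (m + 1) (Lm.sub l) (ps.map (PS.step S))
    | _, _ => false

/-- **Soundness of the loop.** [cite: Moore1966, Ch. 3] -/
theorem colValid_of_goFast (hS : 0 < S) {a : ℝ} (ha0 : 0 < a) {ks : List PrimeLen} {C : Consts}
    (hC : ConstsValid S a ks C) {K K₂ : ℕ} {ctab : List IdxRec} {Lc : MI}
    (hLc : MI.mem S (Real.log Real.pi - Real.log (2 * a)) Lc) :
    ∀ (k m : ℕ) (Lm : MI) (ps : List PS), 1 ≤ m → MI.mem S (Real.log m) Lm → ps.length = ks.length →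
      (∀ i < ks.length, (ps.getD i default).valid S) → goFast S K K₂ C ctab Lc k m Lm ps = true →
      ∀ m', m ≤ m' → m' < m + k → ColValid S a ks m' (tget ctab m')
  | 0, m, Lm, ps, _, _, _, _, _, m', h1, h2 => by omega
  | k + 1, m, Lm, ps, hm, hLm, hlen, hps, h, m', h1, h2 => by
      unfold goFast at h
      split at h
      · rename_i R l hR hl
        rw [Bool.and_eq_true] at h
        obtain ⟨hw, hgo⟩ := h
        by_cases hmm : m' = m
        · subst hmm
          exact ColValid.of_within hw (colValid_of_recFast hS ha0 hC hm hLc hLm hlen hps hR)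
        · have hLm' : MI.mem S (Real.log (((m + 1 : ℕ)) : ℝ)) (Lm.sub l) := by
            have hl' := MI.mem_logOneSub hS hl (MI.mem_ofFrac S 1 (q := m + 1) (by omega))
            refine mem_of_eq (MI.mem_sub hLm hl') ?_
            have hm0 : (0 : ℝ) < m := by exact_mod_cast hm
            have e : (1 : ℝ) - ((1 : ℤ) : ℝ) / ((m + 1 : ℕ) : ℝ) = (m : ℝ) / ((m + 1 : ℕ) : ℝ) := by
              push_cast; field_simp; ring
            rw [e, Real.log_div hm0.ne' (by positivity)]
            ring
          have hlen' : (ps.map (PS.step S)).length = ks.length := by rw [List.length_map, hlen]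
          have hps' : ∀ i < ks.length, ((ps.map (PS.step S)).getD i default).valid S := by
            intro i hi
            rw [List.getD_eq_getElem?_getD, List.getElem?_map,
              show ps[i]? = some (ps.getD i default) by
                rw [List.getD_eq_getElem?_getD, List.getElem?_eq_getElem (by rw [hlen]; exact hi)]; rfl]
            exact PS.valid_step hS (hps i hi)
          exact colValid_of_goFast hS ha0 hC hLc k (m + 1) (Lm.sub l) (ps.map (PS.step S)) (by omega) hLm' hlen'
            hps' hgo m' (by omega) (by omega)
      · simp at h

/-- **The fast light-table checker** on the modes `[m₀, m₀ + k)`: parameters `S` (scale), `K` (log-series terms),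
`K₁` (terms of the one-off logarithms `log m₀`, `log(2a)`), `K₂` (terms of the per-mode `log(1 − 1/(m+1))`),
`g, Kpi, Ks, kr` (guard bits, `π` terms, Taylor terms and halvings of the one-off point exponentials). [cite: Moore1966, Ch. 3] -/
def checkTableColFast (S K K₁ K₂ g Kpi Ks kr : ℕ) (C : Consts) (ctab : List IdxRec) (m₀ k : ℕ) : Bool :=
  match MI.divPos S (C.P.mulInt 1) C.A, MI.divPos S (C.P.mulInt m₀) C.A, MI.logPos S K₁ (C.A.mulInt 2),
      MI.logNat S K₁ m₀ with
  | some om1, some om0, some L2a, some Lm0 =>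
    match omap (mkPS S g Kpi Ks kr om1 om0) C.lens with
    | some ps => goFast S K K₂ C ctab (C.logPi.sub L2a) k m₀ Lm0 ps
    | none => false
  | _, _, _, _ => false

/-- **Soundness of `checkTableColFast`** — the conclusion of `Encl.colValid_of_checkTableCol`, verbatim: every stored
light record of the slice is valid. [cite: Moore1966, Ch. 3] -/
theorem colValid_of_checkTableColFast (hS : 0 < S) {a : ℝ} (ha0 : 0 < a) {ks : List PrimeLen} {C : Consts}
    (hC : ConstsValid S a ks C) {K K₁ K₂ g Kpi Ks kr : ℕ} {ctab : List IdxRec} {m₀ k : ℕ}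
    (h : checkTableColFast S K K₁ K₂ g Kpi Ks kr C ctab m₀ k = true) {m : ℕ} (hm : m₀ ≤ m) (hmk : m < m₀ + k) :
    ColValid S a ks m (tget ctab m) := by
  unfold checkTableColFast at h
  split at h
  · rename_i om1 om0 L2a Lm0 hom1 hom0 hL2a hLm0
    split at h
    · rename_i ps hps
      have hm₀ : 1 ≤ m₀ := by
        rcases Nat.eq_zero_or_pos m₀ with h0 | h0
        · subst h0; simp [MI.logNat] at hLm0
        · exact h0
      have h2a := (MI.mem_logPos hS hL2a (MI.mem_mulInt hC.ha 2)).2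
      have hLc : MI.mem S (Real.log Real.pi - Real.log (2 * a)) (C.logPi.sub L2a) := by
        refine mem_of_eq (MI.mem_sub hC.logPi h2a) ?_
        push_cast; rw [mul_comm]
      have hLm : MI.mem S (Real.log m₀) Lm0 := MI.mem_logNat hS hLm0
      obtain ⟨hpl, hpi⟩ := omap_spec hps
      refine colValid_of_goFast hS ha0 hC hLc k m₀ Lm0 ps hm₀ hLm (by rw [hpl, hC.lens_len]) ?_ h m hm hmk
      intro i hi
      exact valid_mkPS hS (hpi i (by rw [hC.lens_len]; exact hi))
    · simp at h
  · simp at h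


/-! ## 6. `ψ′` with a cheaper shift sum: `((w+j)²)⁻¹ = conj((w+j)²)/|w+j|⁴` from sign-definite squares (same enclosure statement;
measured: `MC.invSqSum` ≈ 10 s per full record in the kernel — 5× `MC.digammaBox` — this form ≈ 2 s, and entrywise within) -/

end FastLight

end Literature.NumberTheory.LFunctions.Yoshida1992.Encl

namespace Literature.Analysis.ValidatedNumerics.NumericsMP

namespace MC

variable {S : ℕ} {w : ℂ}

/-- `((w+j)²)⁻¹ = conj((w+j)²)/|w+j|⁴` with `|w+j|²` taken from the coordinates of `w+j` (all squares of
sign-definite quantities — no product of a big negative box with itself). [cite: Moore1966, Ch. 3 (interval arithmetic)] -/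
def invSqTerm (S : ℕ) (W : MC) (j : ℕ) : Option MC :=
  let Z := W.add (ofInt S (j : ℤ))
  let n4 := ((Z.re.sqr S).add (Z.im.sqr S)).sqr S
  match MI.divPos S (Z.sqr S).re n4, MI.divPos S (Z.sqr S).im.neg n4 with
  | some r, some i => some ⟨r, i⟩
  | _, _ => none

/-- **`invSqTerm ∋ ((w+j)²)⁻¹`.** [cite: Moore1966, Ch. 3 (interval arithmetic)] -/
theorem mem_invSqTerm (hS : 0 < S) {W : MC} (hw : mem S w W) {j : ℕ} {Y : MC}
    (h : invSqTerm S W j = some Y) : mem S (((w + j) ^ 2)⁻¹) Y := by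
  unfold invSqTerm at h
  simp only at h
  split at h
  · rename_i r i hr hi
    simp only [Option.some.injEq] at h
    subst h
    have hz : mem S (w + (j : ℂ)) (W.add (ofInt S (j : ℤ))) := by
      have := mem_add hw (mem_ofInt S (j : ℤ)); push_cast at this; exact this
    set z : ℂ := w + (j : ℂ) with hz_def
    have hB := mem_sqr hS hz
    have hn2 : MI.mem S (Complex.normSq z) (((W.add (ofInt S (j : ℤ))).re.sqr S).add ((W.add (ofInt S (j : ℤ))).im.sqr S)) := by
      rw [Complex.normSq_apply]
      have h1 := MI.mem_add (MI.mem_sqr hS hz.1) (MI.mem_sqr hS hz.2)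
      convert h1 using 1; ring
    have hn4 : MI.mem S (Complex.normSq (z ^ 2)) ((((W.add (ofInt S (j : ℤ))).re.sqr S).add
        ((W.add (ofInt S (j : ℤ))).im.sqr S)).sqr S) := by
      rw [map_pow]; exact MI.mem_sqr hS hn2
    refine ⟨?_, ?_⟩
    · rw [Complex.inv_re]
      have := MI.mem_divPos hS hr hB.1 hn4
      simpa [div_eq_mul_inv, mul_comm] using this
    · rw [Complex.inv_im]
      have := MI.mem_divPos hS hi (MI.mem_neg hB.2) hn4
      simpa [div_eq_mul_inv, mul_comm, neg_mul] using this
  · simp at h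

/-- `Σ_{j<J} ((w+j)²)⁻¹` by `invSqTerm` (measured ≈ 5× cheaper in the kernel than `MC.invSqSum`, and entrywise within it).
[cite: Moore1966, Ch. 3 (interval arithmetic)] -/
def invSqSumFast (S : ℕ) (W : MC) : ℕ → Option MC
  | 0 => some (ofInt S 0)
  | J + 1 =>
    match invSqSumFast S W J, invSqTerm S W J with
    | some A, some B => some (A.add B)
    | _, _ => none

/-- **`invSqSumFast ∋ Σ_{j<J} ((w+j)²)⁻¹`** (the statement of `MC.mem_invSqSum`). [cite: Moore1966, Ch. 3 (interval arithmetic)] -/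
theorem mem_invSqSumFast (hS : 0 < S) {W : MC} (hw : mem S w W) :
    ∀ (J : ℕ) {Y : MC}, invSqSumFast S W J = some Y → mem S (∑ j ∈ Finset.range J, ((w + j) ^ 2)⁻¹) Y
  | 0, Y, h => by
      simp only [invSqSumFast, Option.some.injEq] at h
      subst h
      simpa using mem_ofInt S 0
  | J + 1, Y, h => by
      simp only [invSqSumFast] at h
      split at h
      · rename_i A B hA hB
        simp only [Option.some.injEq] at h
        subst h
        rw [Finset.sum_range_succ]
        exact mem_add (mem_invSqSumFast hS hw J hA) (mem_invSqTerm hS hw hB)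
      · simp at h

/-- `twoKTimes` preserves the length (the tree's copy is private). [folklore] -/
private theorem length_twoKTimes' : ∀ (k : ℕ) (cs : List ℚ), (twoKTimes k cs).length = cs.length
  | _, [] => rfl
  | k, c :: cs => by simp [twoKTimes, length_twoKTimes' (k + 1) cs]

/-- Entries of `twoKTimes` (the tree's copy is private). [folklore] -/
private theorem getD_twoKTimes' : ∀ (k : ℕ) (cs : List ℚ) (i : ℕ), i < cs.length →
    (twoKTimes k cs).getD i 0 = (2 * (k + i) : ℚ) * cs.getD i 0
  | _, [], i, h => by simp at h
  | k, c :: cs, 0, _ => by simp [twoKTimes]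
  | k, c :: cs, i + 1, h => by
      simp only [twoKTimes, List.getD_cons_succ]
      rw [getD_twoKTimes' (k + 1) cs i (by simpa using h)]
      push_cast
      ring

/-- **`ψ′(w)`** exactly as `MC.trigammaBox` but with `invSqSumFast`. [cite: AndrewsAskeyRoy1999, (1.2.14) and Cor 1.4.5] -/
def trigammaBoxFast (S J : ℕ) (cs : List ℚ) (W : MC) : Option MC :=
  if 0 < W.re.lo then
    match divBox S (ofInt S 1) (W.add (ofInt S (J : ℤ))), invSqSumFast S W J with
    | some I, some T =>
        some ((((T.add I).add ((I.sqr S).divNat 2)).add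
          ((bernSeries S (I.sqr S) (twoKTimes 1 cs) 1 (I.sqr S) (ofInt S 0)).mul S I)).widen
          (stirlingRemDerivScaled S cs.length W.re.lo J))
    | _, _ => none
  else none

/-- **`trigammaBoxFast ∋ ψ′(w)`** (the statement of `MC.mem_trigammaBox`; proof verbatim with the shift sum swapped).
[cite: AndrewsAskeyRoy1999, (1.2.14) and Cor 1.4.5] -/
theorem mem_trigammaBoxFast (hS : 0 < S) {J : ℕ} {cs : List ℚ}
    (hcs0 : cs ≠ []) (hcs : ∀ k < cs.length, ((cs.getD k 0 : ℚ) : ℂ) = (bernoulli (2 * (k + 1)) : ℂ))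
    {W Y : MC} (h : trigammaBoxFast S J cs W = some Y) (hw : mem S w W) :
    mem S (deriv Complex.digamma w) Y := by
  unfold trigammaBoxFast at h
  split_ifs at h with hre
  split at h
  · rename_i I T hI hT
    simp only [Option.some.injEq] at h
    subst h
    have hSr : (0 : ℝ) < S := by exact_mod_cast hS
    have hwre : 0 < w.re := MI.pos_of_lo_pos hw.1 hre
    have hWJ : mem S (w + (J : ℂ)) (W.add (ofInt S (J : ℤ))) := by
      have := mem_add hw (mem_ofInt S (J : ℤ)); push_cast at this; exact this
    have hI' : mem S ((w + J)⁻¹) I := by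
      have := mem_divBox hS hI (mem_ofInt S 1) hWJ
      push_cast at this
      rwa [one_div] at this
    have hT' := mem_invSqSumFast hS hw J hT
    have hU : mem S (((w + J)⁻¹) ^ 2) (I.sqr S) := mem_sqr hS hI'
    have hB := mem_bernSeries hS hU (twoKTimes 1 cs) 1 one_pos (by rw [pow_one]; exact hU) (mem_ofInt S 0)
    have hmain := mem_add (mem_add (mem_add hT' hI') (mem_divNat hU (n := 2) two_pos)) (mem_mul hS hB hI')
    set ν := cs.length with hν
    have hν0 : ν ≠ 0 := fun h0 ↦ hcs0 (List.eq_nil_of_length_eq_zero h0)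
    have hlen : (twoKTimes 1 cs).length = ν := by rw [length_twoKTimes']
    have ebern : ((((0 : ℤ) : ℂ) + ∑ i ∈ Finset.range (twoKTimes 1 cs).length,
          (((twoKTimes 1 cs).getD i 0 : ℚ) : ℂ) / (2 * ((1 + i : ℕ) : ℂ)) * (((w + J)⁻¹) ^ 2) ^ (1 + i)) * (w + J)⁻¹) =
        ∑ k ∈ Finset.Icc 1 ν, (bernoulli (2 * k) : ℂ) / (w + J) ^ (2 * k + 1) := by
      rw [hlen, Int.cast_zero, zero_add, ← Finset.Ico_add_one_right_eq_Icc, Finset.sum_Ico_eq_sum_range,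
        show ν + 1 - 1 = ν by omega, Finset.sum_mul]
      refine Finset.sum_congr rfl fun i hi ↦ ?_
      rw [Finset.mem_range] at hi
      have hc := hcs i hi
      rw [getD_twoKTimes' 1 cs i hi]
      rw [show 1 + i = i + 1 by ring] at *
      push_cast
      rw [hc, ← pow_mul, inv_pow]
      have h2 : ((i : ℂ) + 1) ≠ 0 := by
        have : (0 : ℝ) < (i : ℝ) + 1 := by positivity
        exact_mod_cast this.ne'
      have hwJ : (w + (J : ℂ)) ≠ 0 := by
        intro h0; have := congrArg Complex.re h0; simp at this; linarith [Nat.cast_nonneg (α := ℝ) J]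
      field_simp
      ring
    have hmain' : mem S (∑ j ∈ Finset.range J, ((w + j) ^ 2)⁻¹ + 1 / (w + J) + 1 / (2 * (w + J) ^ 2) +
        ∑ k ∈ Finset.Icc 1 ν, (bernoulli (2 * k) : ℂ) / (w + J) ^ (2 * k + 1))
        ((((T.add I).add ((I.sqr S).divNat 2)).add
          ((bernSeries S (I.sqr S) (twoKTimes 1 cs) 1 (I.sqr S) (ofInt S 0)).mul S I))) := by
      convert hmain using 2
      · push_cast
        rw [one_div, one_div, mul_inv, inv_pow]
        ring
      · exact ebern.symm
    -- the remainder
    have hrem := Literature.Analysis.SpecialFunctions.Complex.norm_deriv_digamma_sub_stirlingSeries_shift_le hwre J hν0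
    apply mem_widen hmain'
    set r : ℝ := (W.re.lo : ℝ) / S + J with hr
    have hrpos : 0 < r := by
      have : (0 : ℝ) < W.re.lo := by exact_mod_cast hre
      rw [hr]; positivity
    have hr_le : r ≤ w.re + J := by
      have h1 : (W.re.lo : ℝ) / S ≤ w.re := by rw [div_le_iff₀ hSr]; exact hw.1.1
      rw [hr]; linarith
    have hnorm : w.re + J ≤ ‖w + (J : ℂ)‖ := by
      have := Complex.abs_re_le_norm (w + (J : ℂ))
      simp only [Complex.add_re, Complex.natCast_re] at this
      exact le_trans (le_abs_self _) this
    have hden : r ^ (2 * ν + 2) ≤ ‖w + (J : ℂ)‖ ^ (2 * ν + 1) * (w.re + J) := by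
      rw [pow_succ]
      exact mul_le_mul (pow_le_pow_left₀ hrpos.le (hr_le.trans hnorm) _) hr_le hrpos.le (by positivity)
    have hpi10 : Real.pi ^ 2 ≤ 10 := by nlinarith [Real.pi_pos, Real.pi_lt_d2]
    have hsix : (6 : ℝ) ≤ 2 * Real.pi := by linarith [Real.pi_gt_three]
    have hF : (0 : ℝ) < ((2 * ν + 1).factorial : ℝ) := by positivity
    have hrp : 0 < r ^ (2 * ν + 2) := by positivity
    have h6p : (0 : ℝ) < (6 : ℝ) ^ (2 * ν + 1) := by positivity
    have hpow : (6 : ℝ) ^ (2 * ν + 1) ≤ (2 * Real.pi) ^ (2 * ν + 1) := pow_le_pow_left₀ (by norm_num) hsix _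
    have hν2 : (0 : ℝ) < 2 * ν + 2 := by positivity
    have hA : (2 * ν + 2) * (Real.pi ^ 2 / 3 * ((2 * ν + 1).factorial : ℝ) / (2 * Real.pi) ^ (2 * ν + 1))
        ≤ (2 * ν + 2) * ((10 / 3) * ((2 * ν + 1).factorial : ℝ)) / (6 : ℝ) ^ (2 * ν + 1) := by
      have e1 : (2 * ν + 2) * (Real.pi ^ 2 / 3 * ((2 * ν + 1).factorial : ℝ) / (2 * Real.pi) ^ (2 * ν + 1))
          = (2 * ν + 2) * (Real.pi ^ 2 / 3 * ((2 * ν + 1).factorial : ℝ)) / (2 * Real.pi) ^ (2 * ν + 1) := by ring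
      rw [e1, div_le_div_iff₀ (by positivity) h6p]
      calc (2 * ν + 2) * (Real.pi ^ 2 / 3 * ((2 * ν + 1).factorial : ℝ)) * (6 : ℝ) ^ (2 * ν + 1)
          ≤ (2 * ν + 2) * (10 / 3 * ((2 * ν + 1).factorial : ℝ)) * (6 : ℝ) ^ (2 * ν + 1) := by
            apply mul_le_mul_of_nonneg_right _ h6p.le
            apply mul_le_mul_of_nonneg_left _ hν2.le
            exact mul_le_mul_of_nonneg_right (by linarith) hF.le
        _ ≤ (2 * ν + 2) * (10 / 3 * ((2 * ν + 1).factorial : ℝ)) * (2 * Real.pi) ^ (2 * ν + 1) :=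
            mul_le_mul_of_nonneg_left hpow (by positivity)
    have hR : (2 * ν + 2) * (Real.pi ^ 2 / 3 * ((2 * ν + 1).factorial : ℝ) / (2 * Real.pi) ^ (2 * ν + 1)) /
          (‖w + (J : ℂ)‖ ^ (2 * ν + 1) * (w.re + J))
        ≤ (2 * ν + 2) * ((10 / 3) * ((2 * ν + 1).factorial : ℝ)) / (6 : ℝ) ^ (2 * ν + 1) / r ^ (2 * ν + 2) := by
      rw [div_le_div_iff₀ (lt_of_lt_of_le hrp hden) hrp]
      calc (2 * ν + 2) * (Real.pi ^ 2 / 3 * ((2 * ν + 1).factorial : ℝ) / (2 * Real.pi) ^ (2 * ν + 1)) * r ^ (2 * ν + 2)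
          ≤ (2 * ν + 2) * ((10 / 3) * ((2 * ν + 1).factorial : ℝ)) / (6 : ℝ) ^ (2 * ν + 1) * r ^ (2 * ν + 2) :=
            mul_le_mul_of_nonneg_right hA hrp.le
        _ ≤ (2 * ν + 2) * ((10 / 3) * ((2 * ν + 1).factorial : ℝ)) / (6 : ℝ) ^ (2 * ν + 1) *
              (‖w + (J : ℂ)‖ ^ (2 * ν + 1) * (w.re + J)) :=
            mul_le_mul_of_nonneg_left hden (by positivity)
    have hceil : (S : ℝ) * ((2 * ν + 2) * ((10 / 3) * ((2 * ν + 1).factorial : ℝ)) / (6 : ℝ) ^ (2 * ν + 1) / r ^ (2 * ν + 2))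
        ≤ (stirlingRemDerivScaled S ν W.re.lo J : ℝ) := by
      have hq := Int.le_ceil ((S : ℚ) * ((2 * ν + 2 : ℚ) * ((10 / 3 : ℚ) * ((2 * ν + 1).factorial : ℚ)) /
        ((6 : ℚ) ^ (2 * ν + 1) * ((W.re.lo : ℚ) / S + J) ^ (2 * ν + 2))))
      have hq' := (Rat.cast_le (K := ℝ)).2 hq
      unfold stirlingRemDerivScaled
      rw [Rat.cast_intCast] at hq'
      refine le_trans (le_of_eq ?_) hq'
      rw [hr, div_div]
      push_cast
      ring
    calc ‖deriv Complex.digamma w - (∑ j ∈ Finset.range J, ((w + j) ^ 2)⁻¹ + 1 / (w + J) + 1 / (2 * (w + J) ^ 2) +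
          ∑ k ∈ Finset.Icc 1 ν, (bernoulli (2 * k) : ℂ) / (w + J) ^ (2 * k + 1))‖ * S
        ≤ (2 * ν + 2) * (Real.pi ^ 2 / 3 * ((2 * ν + 1).factorial : ℝ) / (2 * Real.pi) ^ (2 * ν + 1)) /
            (‖w + (J : ℂ)‖ ^ (2 * ν + 1) * (w.re + J)) * S := mul_le_mul_of_nonneg_right hrem hSr.le
      _ ≤ (2 * ν + 2) * ((10 / 3) * ((2 * ν + 1).factorial : ℝ)) / (6 : ℝ) ^ (2 * ν + 1) / r ^ (2 * ν + 2) * S :=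
          mul_le_mul_of_nonneg_right hR hSr.le
      _ = (S : ℝ) * ((2 * ν + 2) * ((10 / 3) * ((2 * ν + 1).factorial : ℝ)) / (6 : ℝ) ^ (2 * ν + 1) / r ^ (2 * ν + 2)) := by
          ring
      _ ≤ (stirlingRemDerivScaled S ν W.re.lo J : ℝ) := hceil
  · simp at h

end MC

end Literature.Analysis.ValidatedNumerics.NumericsMP

namespace Literature.NumberTheory.LFunctions.Yoshida1992.Encl

namespace FastLight

variable {S : ℕ}

/-! ## 7. The FULL table (modes from `1`): `Encl.idxRec`'s fields with `ψ′` by `MC.trigammaBoxFast` and the phases by rotated balls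
(measured per full record on the farm: `trigammaBox` ≈ 10 s of ≈ 13 s; `digammaBox` ≈ 2 s; five `expI` ≈ 1 s) -/

/-- **The fast full record at mode `m`**: `Encl.idxRec` with the phases from the phase states. [cite: Yoshida1992HermitianForms, §5 (5.15)-(5.16) p. 301] -/
def recFullFast (S Kser J : ℕ) (C : Consts) (ps : List PS) (m : ℕ) : Option IdxRec :=
  match MI.divPos S (C.P.mulInt m) C.A with
  | none => none
  | some om =>
    match MI.divPos S (MI.ofInt S 1) ((MI.ofInt S 1).add ((om.sqr S).mulInt 4)),
          MC.digammaBox S Kser J C.P MC.bernoulliTable (quarterBox S om),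
          MC.trigammaBoxFast S J MC.bernoulliTable (quarterBox S om) with
    | some c, some Ψ, some Ψ' =>
      match dsum S (om.sqr S) 0 C.eks, ssum S om (om.sqr S) 0 C.eks with
      | some eD, some eS =>
          some ⟨om, c, Ψ.im, eS.widen C.tailE, List.zipWith (phaseBox S om) C.lens ps, Ψ.re, Ψ'.re, eD.widen C.tailE⟩
      | _, _ => none
    | _, _, _ => none

/-- **`recFullFast` is valid** (proof of `Encl.idxValid_of_idxRec` with the phase field replaced). [cite: Moore1966, Ch. 3] -/
theorem idxValid_of_recFullFast (hS : 0 < S) {a : ℝ} (ha0 : 0 < a) {ks : List PrimeLen} {C : Consts}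
    (hC : ConstsValid S a ks C) {Kser J m : ℕ} {ps : List PS}
    (hlen : ps.length = ks.length) (hps : ∀ i < ks.length, (ps.getD i default).valid S) {R : IdxRec}
    (h : recFullFast S Kser J C ps m = some R) : IdxValid S a ks m R := by
  unfold recFullFast at h
  split at h
  · simp at h
  · rename_i om hom
    split at h
    · rename_i c Ψ Ψ' hc hΨ hΨ'
      split at h
      · rename_i eD eS heD heS
        simp only [Option.some.injEq] at h
        subst h
        have hω : MI.mem S (freq a m) om := by
          refine mem_of_eq (MI.mem_divPos hS hom (MI.mem_mulInt hC.pi m) hC.ha) ?_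
          unfold freq; push_cast; ring
        have hω2 : MI.mem S (freq a m ^ 2) (om.sqr S) := MI.mem_sqr hS hω
        have hW := mem_quarterBox (S := S) hω
        have hψ := MC.mem_digammaBox_table hS hC.pi hΨ hW
        have hψ' := MC.mem_trigammaBoxFast hS (by simp [MC.bernoulliTable]) bernoulliTable_spec hΨ' hW
        have hK : 1 ≤ C.eks.length := hC.eks_pos
        have heD' := mem_dsum (a := a) hS hω2 C.eks 0 (fun i hi ↦ by simpa using hC.eks i hi) heD
        have heS' := mem_ssum (a := a) hS hω hω2 C.eks 0 (fun i hi ↦ by simpa using hC.eks i hi) heS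
        simp only [Nat.zero_add] at heD' heS'
        have htailD : |archExpSumDiag a m - ∑ i ∈ Finset.range C.eks.length, diagTerm a m i| * S ≤ C.tailE :=
          le_trans (mul_le_mul_of_nonneg_right (abs_archExpSumDiag_sub_sum_le ha0 m hK) (Nat.cast_nonneg _)) hC.tail
        have htailS : |archExpSumSin a m - ∑ i ∈ Finset.range C.eks.length, sinTerm a m i| * S ≤ C.tailE :=
          le_trans (mul_le_mul_of_nonneg_right (abs_archExpSumSin_sub_sum_le ha0 m _) (Nat.cast_nonneg _)) hC.tail
        refine ⟨{ om := hω, c := ?_, imP := hψ.2, eS := MI.mem_widen heS' htailS, cs_len := ?_, cs := ?_ },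
          { reP := hψ.1, rePD := hψ'.1, eD := MI.mem_widen heD' htailD }⟩
        · refine mem_of_eq (MI.mem_divPos hS hc (MI.mem_ofInt S 1)
            (MI.mem_add (MI.mem_ofInt S 1) (MI.mem_mulInt hω2 4))) ?_
          push_cast; ring
        · simp only [List.length_zipWith, hlen, hC.lens_len, min_self]
        · intro i hi
          simp only
          rw [getD_zipWith (phaseBox S om) default default default C.lens ps i (by rw [hC.lens_len]; exact hi)
            (by rw [hlen]; exact hi)]
          exact mem_phaseBox hS hω (hC.lens i hi) (hps i hi)
      · simp at h
    · simp at h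

/-- **The loop over the full table** `m, m+1, …`. [cite: Moore1966, Ch. 3] -/
def goFullFast (S Kser J : ℕ) (C : Consts) (tab : List IdxRec) : ℕ → ℕ → List PS → Bool
  | 0, _, _ => true
  | k + 1, m, ps =>
    match recFullFast S Kser J C ps m with
    | some R => IdxRec.within R (tget tab m) && goFullFast S Kser J C tab k (m + 1) (ps.map (PS.step S))
    | none => false

/-- **Soundness of the full-table loop.** [cite: Moore1966, Ch. 3] -/
theorem idxValid_of_goFullFast (hS : 0 < S) {a : ℝ} (ha0 : 0 < a) {ks : List PrimeLen} {C : Consts}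
    (hC : ConstsValid S a ks C) {Kser J : ℕ} {tab : List IdxRec} :
    ∀ (k m : ℕ) (ps : List PS), ps.length = ks.length → (∀ i < ks.length, (ps.getD i default).valid S) →
      goFullFast S Kser J C tab k m ps = true → ∀ m', m ≤ m' → m' < m + k → IdxValid S a ks m' (tget tab m')
  | 0, m, ps, _, _, _, m', h1, h2 => by omega
  | k + 1, m, ps, hlen, hps, h, m', h1, h2 => by
      unfold goFullFast at h
      split at h
      · rename_i R hR
        rw [Bool.and_eq_true] at h
        obtain ⟨hw, hgo⟩ := h
        by_cases hmm : m' = m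
        · subst hmm
          exact IdxValid.of_within hw (idxValid_of_recFullFast hS ha0 hC hlen hps hR)
        · have hlen' : (ps.map (PS.step S)).length = ks.length := by rw [List.length_map, hlen]
          have hps' : ∀ i < ks.length, ((ps.map (PS.step S)).getD i default).valid S := by
            intro i hi
            rw [List.getD_eq_getElem?_getD, List.getElem?_map,
              show ps[i]? = some (ps.getD i default) by
                rw [List.getD_eq_getElem?_getD, List.getElem?_eq_getElem (by rw [hlen]; exact hi)]; rfl]
            exact PS.valid_step hS (hps i hi)
          exact idxValid_of_goFullFast hS ha0 hC k (m + 1) (ps.map (PS.step S)) hlen' hps' hgo m' (by omega) (by omega)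
      · simp at h

/-- **The fast full-table checker** on `[n₀, n₀ + k)` (`Kser`, `J` = the rung's evaluator parameters for `ψ`, `ψ′`;
`g, Kpi, Ks, kr` as in `checkTableColFast`). [cite: Moore1966, Ch. 3] -/
def checkTableFast (S Kser J g Kpi Ks kr : ℕ) (C : Consts) (tab : List IdxRec) (n₀ k : ℕ) : Bool :=
  match MI.divPos S (C.P.mulInt 1) C.A, MI.divPos S (C.P.mulInt n₀) C.A with
  | some om1, some om0 =>
    match omap (mkPS S g Kpi Ks kr om1 om0) C.lens with
    | some ps => goFullFast S Kser J C tab k n₀ ps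
    | none => false
  | _, _ => false

/-- **Soundness of `checkTableFast`** — the conclusion of `Encl.idxValid_of_checkTable`, verbatim. [cite: Moore1966, Ch. 3] -/
theorem idxValid_of_checkTableFast (hS : 0 < S) {a : ℝ} (ha0 : 0 < a) {ks : List PrimeLen} {C : Consts}
    (hC : ConstsValid S a ks C) {Kser J g Kpi Ks kr : ℕ} {tab : List IdxRec} {n₀ k : ℕ}
    (h : checkTableFast S Kser J g Kpi Ks kr C tab n₀ k = true) {n : ℕ} (hn : n₀ ≤ n) (hnk : n < n₀ + k) :
    IdxValid S a ks n (tget tab n) := by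
  unfold checkTableFast at h
  split at h
  · rename_i om1 om0 hom1 hom0
    split at h
    · rename_i ps hps
      obtain ⟨hpl, hpi⟩ := omap_spec hps
      refine idxValid_of_goFullFast hS ha0 hC k n₀ ps (by rw [hpl, hC.lens_len]) ?_ h n hn hnk
      intro i hi
      exact valid_mkPS hS (hpi i (by rw [hC.lens_len]; exact hi))
    · simp at h
  · simp at h

end FastLight

end Literature.NumberTheory.LFunctions.Yoshida1992.Encl
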